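import Literature.NumberTheory.LFunctions.BPZSecondMomentSingularSum
import Mathlib.NumberTheory.ArithmeticFunction.Liouville
import HarnessLib

/-!
# Bui–Pratt–Zaharescu 2024, §4 and §6 (6.7): the order-two main-term brackets of the mollified
# product moments for GENERAL mollifier coefficients, and the frozen-character evaluation rule
# (cell landau-siegel, §B-fam, upgrade item U2; definitions and proved bookkeeping only, no fact)

Source: H. M. Bui, K. Pratt, A. Zaharescu, *Analytic ranks of automorphic L-functions and
Landau–Siegel zeros*, J. London Math. Soc. 109 (2024) = arXiv:2102.03087 [held:
paper:arxiv-2102.03087]: §4 (p. 11 bottom – p. 12 top: the residues at `k = 1, 2`), §6 (6.2)–(6.7)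
(pp. 17–19: `M^D_k`, `W(u,v)`, `S₂(u,v)`, the residues `R₁`, `R₂` and the displays (6.6)/(6.7)),
Props. 2.1–2.3 (p. 6). Continues `BPZFirstMomentSingularSum` (`oneStarPsi`, `singularSum` = `S_ρ(u)`)
and `BPZSecondMomentSingularSum` (`rho2`, `singularSum2` = `S₂(u,v)[ρ]`), namespace `BPZ2024`, same
conventions (`q` prime, `ψ` real odd primitive mod `D`, `Q = qD/4π² = Qbpz q D`). Typed for the
LANDAU–SIEGEL PROGRAMME, cell `landau-siegel`, §B-fam, `B-fam/UPGRADE-BRIEF.md` v1.3 §U2 («the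
SECOND-FORM bracket of `singularSum2` (BPZ24 §§6–7, the ψ-dependent cross terms)»): the objects the
cell's num seats evaluate over `ρ` at a compatible prime level. FRAMING: the programme SEARCHES and
TYPES; nothing here is a claim about Landau–Siegel zeros; NOTHING is asserted (definitions + proved
algebra only).

## What is printed (pages read 2026-08-27) and what is typed

* §4, p. 11–12: for the mollifier `M = Σ_{n≤X} ρ₁(n)λ_f(n)n^{−1/2}` the residue of
  `k!(1+(−1)^{k+1}ψ(q))·G(u)Γ(1+u)²Q^uL(1+2u,ψ)S₁(u)u^{−k−1}` at `u = 0` is, at `k = 2`,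
  `4(1−ψ(q))S₁(0)(L″(1,ψ) + (log Q − 2γ)L′(1,ψ)) + 4(1−ψ(q))S₁′(0)L′(1,ψ) + O_ε(L(1,ψ)(log q)^{6+ε})`,
  `S₁(u) = Σ_{n≤X} ρ₁(n)(1⋆ψ)(n)n^{−1−u}` (4.1). The computation uses `ρ₁` only through (4.1) and the
  bound `ρ₁(n) ≪ (log q)^ε τ(n)`; for a general coefficient sequence `ρ` the same display holds with
  `S₁ ↦ S_ρ = singularSum ρ ψ X` — typed as the DEFINITION `firstMainTwo` (with `S_ρ′(0)` =
  `singularSumDeriv`) and `bracketB L′ L″ Q = L″ + (log Q − 2γ)L′`. The values `L′(1,ψ)`, `L″(1,ψ)`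
  enter as free parameters `L1 L2 : ℂ` (num seats insert the (A)-world data; nothing about them is
  asserted here).
* §6 (6.7), p. 19: the diagonal main term of `Σʰ Λ″_{f,ψ}(½)² M²` is
  `16(1−ψ(q))²[S₂(0,0)B² + 2∂_uS₂(0,0)L′(1,ψ)B + ∂²_{uv}S₂(0,0)L′(1,ψ)²] + O_ε(L(1,ψ)(log q)^{39+ε})
  + O_A((log q)^{−A}) + O_ε(q^{−1/4+ε}D^{−1/4}X^{3/4})`, `B = L″(1,ψ) + (log Q − 2γ)L′(1,ψ)`,
  `S₂(u,v)` of (6.5); again `ρ` enters only through `ρ₂ = ρ₂[ρ]` ((2.5)) and the bound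
  `ρ₂ ≪ (log q)^{4+ε}τ₄`. Typed: `singularSum2Du` (`∂_uS₂(0,0)[ρ]`), `singularSum2Duv`
  (`∂²_{uv}S₂(0,0)[ρ]`), `secondMainTwo` (the bracket), and `csRatioTwo = |first|²/|second|`, the
  main-order Cauchy–Schwarz lower bound for the harmonic proportion of `{Λ″_{f,ψ}(½) ≠ 0}` = the cell's
  «BPZ-compatible functional» at derivative order `2` for general `ρ` (the printed instance `ρ = ρ₁`
  has `S₂ = S₁²`, Props. 2.1/2.3, ratio `→ 1`: «perfect mollification», Thm. 1.2).
* ORDER ZERO (the order relevant to the Iwaniec–Sarnak mechanism) is NOT a bracket of this kind: the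
  order-0 first moment is the simple-pole residue `(1−ψ(q))L(1,ψ)S_ρ(0)` (typed as the derivation
  target `BPZ2024.OrderZeroProductMoment`, `BPZProductMomentOrderZero`), and at `k = 0` the printed
  second-moment analysis ((6.4): `W = S₂ + O_ε(L(1,ψ)(log q)^{33+ε}) + O_A((log q)^{−A})`) only
  BOUNDS `Σʰ Λ_{f,ψ}(½)²M²` by `O(L(1,ψ)(log q)^{35+ε})`, a quantity larger than the formal double
  residue `(1−ψ(q))²L(1,ψ)²S₂(0,0)[ρ]`; so no order-zero proportion functional is determined by the
  printed main terms (recorded in the cell note `B-fam/typer-1/U2-SCOPING.md`; nothing about it is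
  typed here).
* THE FROZEN-CHARACTER («(A)-data») EVALUATION RULE, PROVED: if `ψ(p) = −1` for every prime `p ∣ n`
  (the extremal exceptional pattern on the mollifier range; the admissible deviations are controlled
  by the lacunarity lemmas of `ExceptionalCharacterLacunarity`), then `ψ(d) = λ(d)` (Liouville) for
  every `d ∣ n` and `(1⋆ψ)(n) = Σ_{d∣n} λ(d)` (`= 1` if `n` is a square, `0` otherwise:
  `LiouvilleSumClassicalBound.sum_divisors_liouville`), so that every functional above becomes an
  explicit ψ-free finite sum on frozen data (`singularSum_frozen`).

## References

* [BuiPrattZaharescu2023] §4 pp. 11–12; §6 (6.2)–(6.7) pp. 17–19; Props. 2.1–2.3 p. 6; Thm. 1.2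
  p. 3; (2.5) p. 5 (held text pages p0005, p0006, p0011, p0012, p0017, p0018, p0019).
-/

noncomputable section

open scoped Real
open Complex Finset ArithmeticFunction

namespace Literature.NumberTheory.LFunctions

namespace BPZ2024

variable {D : ℕ}

/-! ### Derivatives of the singular sums at the origin (general coefficients) -/

/-- **`S_ρ′(0) = −Σ_{1≤n≤X} ρ(n)(1⋆ψ)(n)(log n)/n`**, the `u`-derivative at `0` of
`singularSum ρ ψ X u = Σ ρ(n)(1⋆ψ)(n)n^{−1−u}` (for `ρ = ρ₁`: the `S₁′(0)` of the `k = 2` residue,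
p. 12 top, bounded in Lemma 5.2). [cite: BuiPrattZaharescu2023, §4 p. 12 (the term `4(1−ψ(q))S₁′(0)L′(1,ψ)`) (derivation: general coefficients)] -/
def singularSumDeriv (ρ : ℕ → ℂ) (ψ : DirichletCharacter ℂ D) (X : ℝ) : ℂ :=
  -∑ n ∈ Icc 1 ⌊X⌋₊, ρ n * oneStarPsi ψ n * ((Real.log n : ℝ) : ℂ) / (n : ℂ)

/-- **`∂_u S₂(0,0)[ρ] = −Σ_{ab≤X²} ρ₂[ρ](ab)(ab)^{−1} Σ_{n≤X} (1⋆ψ)(an)(1⋆ψ)(bn) n^{−1}(log a + log n)`**,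
from `S₂(u,v) = Σ_{ab≤X²} ρ₂(ab)a^{−1−u}b^{−1−v}Σ_{n≤X}(1⋆ψ)(an)(1⋆ψ)(bn)n^{−1−u−v}` (6.5).
[cite: BuiPrattZaharescu2023, §6 (6.5) p. 18 and (6.7) p. 19 (derivation: general coefficients)] -/
def singularSum2Du (ρ : ℕ → ℂ) (ψ : DirichletCharacter ℂ D) (X : ℝ) : ℂ :=
  -∑ a ∈ Icc 1 ⌊X ^ 2⌋₊, ∑ b ∈ Icc 1 ⌊X ^ 2⌋₊,
    if ((a * b : ℕ) : ℝ) ≤ X ^ 2 then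
      rho2 ρ X (a * b) / ((a : ℂ) * (b : ℂ)) *
        ∑ n ∈ Icc 1 ⌊X⌋₊, oneStarPsi ψ (a * n) * oneStarPsi ψ (b * n) / (n : ℂ) *
          (((Real.log a : ℝ) : ℂ) + ((Real.log n : ℝ) : ℂ))
    else 0

/-- **`∂²_{uv} S₂(0,0)[ρ] = Σ_{ab≤X²} ρ₂[ρ](ab)(ab)^{−1} Σ_{n≤X} (1⋆ψ)(an)(1⋆ψ)(bn) n^{−1}
(log a + log n)(log b + log n)`** (from (6.5)).
[cite: BuiPrattZaharescu2023, §6 (6.5) p. 18 and (6.7) p. 19 (derivation: general coefficients)] -/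
def singularSum2Duv (ρ : ℕ → ℂ) (ψ : DirichletCharacter ℂ D) (X : ℝ) : ℂ :=
  ∑ a ∈ Icc 1 ⌊X ^ 2⌋₊, ∑ b ∈ Icc 1 ⌊X ^ 2⌋₊,
    if ((a * b : ℕ) : ℝ) ≤ X ^ 2 then
      rho2 ρ X (a * b) / ((a : ℂ) * (b : ℂ)) *
        ∑ n ∈ Icc 1 ⌊X⌋₊, oneStarPsi ψ (a * n) * oneStarPsi ψ (b * n) / (n : ℂ) *
          ((((Real.log a : ℝ) : ℂ) + ((Real.log n : ℝ) : ℂ)) *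
            (((Real.log b : ℝ) : ℂ) + ((Real.log n : ℝ) : ℂ)))
    else 0

/-! ### The order-two main-term brackets -/

/-- **`B = L″(1,ψ) + (log Q − 2γ)L′(1,ψ)`**, the combination of `L′(1,ψ) = L1`, `L″(1,ψ) = L2` that the
`k = 2` residues produce (`Γ′(1) = −γ`). [cite: BuiPrattZaharescu2023, §4 p. 11 (residue at `k = 2`) and Prop. 2.1 p. 6 (derivation: notation)] -/
def bracketB (L1 L2 : ℂ) (Q : ℝ) : ℂ :=
  L2 + (((Real.log Q : ℝ) : ℂ) - 2 * ((Real.eulerMascheroniConstant : ℝ) : ℂ)) * L1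

/-- **The order-two first main term for general coefficients**:
`4(1−ψ(q))[S_ρ(0)·B + S_ρ′(0)·L′(1,ψ)]`, the residue of §4 at `k = 2` with `S₁ ↦ S_ρ`
(`= Σʰ Λ″_{f,ψ}(½)M_ρ` up to `O_ε(L(1,ψ)(log q)^{6+ε}) + O_ε(q^{−1/2+ε}DX)` in the printed case
`ρ = ρ₁`; for general `ρ` a DERIVATION — the computation of §4 is coefficient-agnostic given
`ρ(n) ≪ (log q)^ε τ(n)`). [cite: BuiPrattZaharescu2023, §4 pp. 11–12 (residue at `k = 2`) (derivation: general coefficients)] -/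
def firstMainTwo (q : ℕ) (ρ : ℕ → ℂ) (ψ : DirichletCharacter ℂ D) (X : ℝ) (L1 L2 : ℂ) : ℂ :=
  4 * (1 - ψ q) *
    (singularSum ρ ψ X 0 * bracketB L1 L2 (Qbpz q D) + singularSumDeriv ρ ψ X * L1)

/-- **The order-two diagonal second main term for general coefficients** ((6.7) with
`S₂ ↦ S₂[ρ]`): `16(1−ψ(q))²[S₂(0,0)B² + 2∂_uS₂(0,0)L′B + ∂²_{uv}S₂(0,0)L′²]` (`= M^D_2` up to the
printed errors for `ρ = ρ₁`; for general `ρ` a DERIVATION, `ρ` entering through `ρ₂[ρ]` only).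
[cite: BuiPrattZaharescu2023, §6 (6.7) p. 19 (derivation: general coefficients)] -/
def secondMainTwo (q : ℕ) (ρ : ℕ → ℂ) (ψ : DirichletCharacter ℂ D) (X : ℝ) (L1 L2 : ℂ) : ℂ :=
  16 * (1 - ψ q) ^ 2 *
    (singularSum2 ρ ψ X 0 0 * bracketB L1 L2 (Qbpz q D) ^ 2 +
      2 * singularSum2Du ρ ψ X * L1 * bracketB L1 L2 (Qbpz q D) +
      singularSum2Duv ρ ψ X * L1 ^ 2)

/-- **The order-two Cauchy–Schwarz functional** `|first|²/|second|`: the main-order lower bound for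
the harmonic proportion of `{f : Λ″_{f,ψ}(½) ≠ 0}` («`Σʰ_{Λ″≠0} 1 ≥ (Σʰ Λ″M)²/Σʰ(Λ″M)²`», `Σʰ 1 =
1 + O(q^{−3/2})`), as a function of the design `ρ` and of the data `(ψ, L′(1,ψ), L″(1,ψ))`. At
`ρ = ρ₁` it tends to `1` (Props. 2.1/2.3: `S₂ = S₁²`; Thm. 1.2).
[cite: BuiPrattZaharescu2023, Props. 2.1–2.3 p. 6 and Thm. 1.2 p. 3 (derivation: general coefficients)] -/
def csRatioTwo (q : ℕ) (ρ : ℕ → ℂ) (ψ : DirichletCharacter ℂ D) (X : ℝ) (L1 L2 : ℂ) : ℝ :=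
  ‖firstMainTwo q ρ ψ X L1 L2‖ ^ 2 / ‖secondMainTwo q ρ ψ X L1 L2‖

/-- `csRatioTwo ≥ 0`. [cite: BuiPrattZaharescu2023, Thm. 1.2 p. 3 (derivation)] -/
theorem csRatioTwo_nonneg (q : ℕ) (ρ : ℕ → ℂ) (ψ : DirichletCharacter ℂ D) (X : ℝ) (L1 L2 : ℂ) :
    0 ≤ csRatioTwo q ρ ψ X L1 L2 :=
  div_nonneg (sq_nonneg _) (norm_nonneg _)

/-- In the INCOMPATIBLE case `ψ(q) = 1` both order-two brackets vanish (the factor `1 − ψ(q)`):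
the even-derivative moments live on the compatible class `ψ(q) = −1`.
[cite: BuiPrattZaharescu2023, Props. 2.1/2.3 p. 6 (the factor `(1 − ψ(q))`) (derivation)] -/
theorem firstMainTwo_of_psi_eq_one {q : ℕ} {ψ : DirichletCharacter ℂ D} (h : ψ q = 1)
    (ρ : ℕ → ℂ) (X : ℝ) (L1 L2 : ℂ) : firstMainTwo q ρ ψ X L1 L2 = 0 := by
  simp [firstMainTwo, h]

/-- See `firstMainTwo_of_psi_eq_one`. [cite: BuiPrattZaharescu2023, Props. 2.1/2.3 p. 6 (derivation)] -/
theorem secondMainTwo_of_psi_eq_one {q : ℕ} {ψ : DirichletCharacter ℂ D} (h : ψ q = 1)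
    (ρ : ℕ → ℂ) (X : ℝ) (L1 L2 : ℂ) : secondMainTwo q ρ ψ X L1 L2 = 0 := by
  simp [secondMainTwo, h]

/-! ### The frozen-character evaluation rule -/

/-- **Frozen character ⇒ Liouville.** If `ψ(p) = −1` for every prime `p ∣ n` (`n ≠ 0`), then
`ψ(n) = λ(n)` (Liouville's function): the extremal exceptional («(A)-world») pattern on the support,
under which every `ψ`-dependent coefficient of the brackets above is an explicit integer.
[cite: BuiPrattZaharescu2023, Lemma 3.5 p. 8 and §5 p. 13 (the cases `ψ(p) ∈ {−1, 0, 1}`) (derivation: evaluation rule)] -/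
theorem psi_eq_liouville_of_frozen (ψ : DirichletCharacter ℂ D) {n : ℕ} (hn : n ≠ 0)
    (h : ∀ p : ℕ, p.Prime → p ∣ n → ψ p = -1) : ψ n = ((liouville n : ℤ) : ℂ) := by
  induction n using induction_on_primes with
  | zero => exact absurd rfl hn
  | one => simp [liouville_apply_one]
  | prime_mul p m hp ih =>
    have hm : m ≠ 0 := fun h0 => hn (by rw [h0, mul_zero])
    have hψp : ψ p = -1 := h p hp (dvd_mul_right p m)
    have ihm : ψ m = ((liouville m : ℤ) : ℂ) :=
      ih hm fun r hr hrm => h r hr (dvd_mul_of_dvd_right hrm p)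
    have hlp : liouville p = -1 := by
      rw [liouville_apply hp.ne_zero, cardFactors_apply_prime hp, pow_one]
    rw [Nat.cast_mul, map_mul, hψp, ihm, liouville_apply_mul, hlp]
    push_cast
    ring

/-- **`(1⋆ψ)(n) = Σ_{d∣n} λ(d)`** on frozen data (`ψ(p) = −1` for all primes `p ∣ n`): the
divisor sum of the brackets becomes the Liouville divisor sum, i.e. the indicator of the squares
(`LiouvilleSumClassicalBound.sum_divisors_liouville`). [cite: BuiPrattZaharescu2023, Lemma 3.4 p. 7 (`1⋆ψ`) and §5 p. 13 (derivation: evaluation rule)] -/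
theorem oneStarPsi_frozen (ψ : DirichletCharacter ℂ D) {n : ℕ}
    (h : ∀ p : ℕ, p.Prime → p ∣ n → ψ p = -1) :
    oneStarPsi ψ n = ∑ d ∈ n.divisors, ((liouville d : ℤ) : ℂ) := by
  unfold oneStarPsi
  refine Finset.sum_congr rfl fun d hd => ?_
  have hdn : d ∣ n := Nat.dvd_of_mem_divisors hd
  have hd0 : d ≠ 0 := Nat.pos_iff_ne_zero.mp (Nat.pos_of_mem_divisors hd)
  exact psi_eq_liouville_of_frozen ψ hd0 fun p hp hpd => h p hp (hpd.trans hdn)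

/-- **Frozen on a range.** `IsFrozenOn ψ Y`: `ψ(p) = −1` for every prime `p ≤ Y` — the extremal
exceptional pattern on `[1, Y]` (the admissible (A)-world patterns deviate from it on a set of primes
of small harmonic mass, `ExceptionalCharacterLacunarity`). [cite: BuiPrattZaharescu2023, Lemma 3.5 p. 8 (lacunarity of `1⋆ψ`) (derivation: evaluation rule)] -/
def IsFrozenOn (ψ : DirichletCharacter ℂ D) (Y : ℝ) : Prop :=
  ∀ p : ℕ, p.Prime → (p : ℝ) ≤ Y → ψ p = -1

/-- A character frozen on `[1, Y]` is frozen on the divisors of every `1 ≤ n ≤ Y`.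
[cite: BuiPrattZaharescu2023, Lemma 3.5 p. 8 (derivation: bookkeeping)] -/
theorem IsFrozenOn.apply_dvd {ψ : DirichletCharacter ℂ D} {Y : ℝ} (hY : IsFrozenOn ψ Y) {n : ℕ}
    (hn : n ≠ 0) (hnY : (n : ℝ) ≤ Y) {p : ℕ} (hp : p.Prime) (hpn : p ∣ n) : ψ p = -1 :=
  hY p hp ((Nat.cast_le.mpr (Nat.le_of_dvd (Nat.pos_iff_ne_zero.mpr hn) hpn)).trans hnY)

/-- **The evaluation rule for the first singular sum at the origin**: on a character frozen on
`[1, X]`, `S_ρ(0) = Σ_{1≤n≤X} ρ(n)·(Σ_{d∣n}λ(d))·n^{−1}` — a ψ-free finite sum (only the square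
`n` survive). [cite: BuiPrattZaharescu2023, §4 (4.1) p. 11 (derivation: evaluation rule)] -/
theorem singularSum_frozen {ψ : DirichletCharacter ℂ D} {X : ℝ} (hX : IsFrozenOn ψ X) (ρ : ℕ → ℂ) :
    singularSum ρ ψ X 0 =
      ∑ n ∈ Icc 1 ⌊X⌋₊, ρ n * (∑ d ∈ n.divisors, ((liouville d : ℤ) : ℂ)) * (n : ℂ) ^ (-(1 + 0 : ℂ)) := by
  unfold singularSum
  refine Finset.sum_congr rfl fun n hn => ?_
  have hn1 : 1 ≤ n := (Finset.mem_Icc.mp hn).1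
  have hn0 : n ≠ 0 := Nat.pos_iff_ne_zero.mp hn1
  have hnX : (n : ℝ) ≤ X := by
    have hle : n ≤ ⌊X⌋₊ := (Finset.mem_Icc.mp hn).2
    have hX0 : 0 ≤ X := by
      by_contra hneg
      have : ⌊X⌋₊ = 0 := Nat.floor_of_nonpos (le_of_lt (not_le.mp hneg))
      omega
    exact (Nat.cast_le.mpr hle).trans (Nat.floor_le hX0)
  rw [oneStarPsi_frozen ψ fun p hp hpn => hX.apply_dvd hn0 hnX hp hpn]

end BPZ2024

end Literature.NumberTheory.LFunctions

end
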